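import Summits.Ventures.PercRepro.CoreRegimes

/-!
# PercRepro — THEOREM R3 from `p ≥ 63`: the regime A / B′ inequalities for every `p ≥ 63`, `d ≥ 6` (p2, gen 11)

`CoreRegimes.lean` proves the regime A / B′ inequalities of night-1's `q = 3` counting route for every `p ≥ 201`
(the threshold of residue (R3)). The same seven-lemma proof, with its constants re-derived, works from `p = 63`:
the tail lemma `10⁴·n⁹ ≤ 2ⁿ` holds from `n = 69`, `C(n,3) ≥ 11·n²` from `n = 69` (so `α″ = 2 + ρ + 1/11 = 1509/385`
absorbs the polynomial terms, `R₃ ≤ 4.2·C(n,3)`), the A1 ratio is `((p+9)/(p+1))³ ≤ (9/8)³` at `p ≥ 63`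
(`α″·(9/8)³/8 = 0.699`), and `80·(4p+2)³ ≤ 4^p`, `2^{k+10} ≤ 3^k` hold from `p = 63`, `k = 59`. Nothing else changes.
The exact table (`regimes_all_200.out`, ref-2's `r3check`) covers `9 ≤ p ≤ 200`; this file makes the cells
`63 ≤ p ≤ 200`, `d ≥ 6` kernel as well, so that `CoreCount.c025_core_of_regime` holds from `p = 63`.

* `ten_thousand_pow_nine_le_two_pow_low` (`n ≥ 69`), `choose_three_ge_eleven_sq` (`n ≥ 69`), `eighty_mul_cube_le_four_pow_low`
  (`p ≥ 63`), `two_pow_le_three_pow_low` (`k ≥ 59`) — the four numeric lemmas at the lower thresholds;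
* `alphaL = 1509/385`, `lhsU_le_low`, the tails, the cases `regimeA_of_le_nine_low` / `_sub_two_low` / `_three_mul_low`, `regimeB_of_le_low`;
* **`regimeA_of_le_low`**, **`regimeB_of_le_low`**, **`regime_of_six_le_low`** — THEOREM R3 for every `p ≥ 63`, `d ≥ 6`.
Imports `CoreRegimes` only. Axioms: standard.
-/

namespace PercRepro
namespace CoreRegimes

open Finset

/-! ### The four numeric lemmas at the lower thresholds -/

/-- `10⁴·n⁹ ≤ 2ⁿ` for every `n ≥ 69`. -/
theorem ten_thousand_pow_nine_le_two_pow_low (n : ℕ) (hn : 69 ≤ n) : 10000 * n ^ 9 ≤ 2 ^ n := by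
  induction n, hn using Nat.le_induction with
  | base => norm_num
  | succ k hk ih =>
    have h1 : 69 * (k + 1) ≤ 70 * k := by omega
    have h2 : (69 * (k + 1)) ^ 9 ≤ (70 * k) ^ 9 := Nat.pow_le_pow_left h1 9
    have h3 : 70 ^ 9 ≤ 2 * 69 ^ 9 := by norm_num
    have h4 : (k + 1) ^ 9 ≤ 2 * k ^ 9 := by
      have : 69 ^ 9 * (k + 1) ^ 9 ≤ 2 * 69 ^ 9 * k ^ 9 := by
        calc 69 ^ 9 * (k + 1) ^ 9 = (69 * (k + 1)) ^ 9 := by ring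
          _ ≤ (70 * k) ^ 9 := h2
          _ = 70 ^ 9 * k ^ 9 := by ring
          _ ≤ 2 * 69 ^ 9 * k ^ 9 := by nlinarith [h3, Nat.zero_le (k ^ 9)]
      have hpos : 0 < 69 ^ 9 := by positivity
      nlinarith [this, hpos]
    calc 10000 * (k + 1) ^ 9 ≤ 10000 * (2 * k ^ 9) := by gcongr
      _ = 2 * (10000 * k ^ 9) := by ring
      _ ≤ 2 * 2 ^ k := by gcongr
      _ = 2 ^ (k + 1) := by ring

/-- `11·n² ≤ C(n,3)` for `n ≥ 69`. -/
theorem choose_three_ge_eleven_sq (n : ℕ) (hn : 69 ≤ n) : 11 * n ^ 2 ≤ Nat.choose n 3 := by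
  obtain ⟨m, rfl⟩ : ∃ m, n = m + 2 := ⟨n - 2, by omega⟩
  have h := six_mul_choose_three m
  have hm : 67 ≤ m := by omega
  nlinarith [h, hm]

/-- `80·(4p+2)³ ≤ 4^p` for `p ≥ 63`. -/
theorem eighty_mul_cube_le_four_pow_low (p : ℕ) (hp : 63 ≤ p) : 80 * (4 * p + 2) ^ 3 ≤ 4 ^ p := by
  induction p, hp using Nat.le_induction with
  | base => norm_num
  | succ k hk ih =>
    have h1 : (4 * (k + 1) + 2) ^ 3 ≤ 4 * (4 * k + 2) ^ 3 := by
      set t := 4 * k + 2 with ht_def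
      have ht : 254 ≤ t := by omega
      have hsq : 254 * t ^ 2 ≤ t ^ 3 := by
        calc 254 * t ^ 2 ≤ t * t ^ 2 := Nat.mul_le_mul_right _ ht
          _ = t ^ 3 := by ring
      have hlin : t ≤ t ^ 2 := by nlinarith [ht]
      have hone : 1 ≤ t ^ 2 := by nlinarith [ht]
      have h4 : 4 * (k + 1) + 2 = t + 4 := by omega
      rw [h4]
      nlinarith [hsq, hlin, hone]
    calc 80 * (4 * (k + 1) + 2) ^ 3 ≤ 80 * (4 * (4 * k + 2) ^ 3) := by gcongr
      _ = 4 * (80 * (4 * k + 2) ^ 3) := by ring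
      _ ≤ 4 * 4 ^ k := by gcongr
      _ = 4 ^ (k + 1) := by ring

/-- `2^{k+10} ≤ 3^k` for `k ≥ 59`. -/
theorem two_pow_le_three_pow_low (k : ℕ) (hk : 59 ≤ k) : 2 ^ (k + 4 + 6) ≤ 3 ^ k := by
  rw [show k + 4 + 6 = k + 10 by omega]
  induction k, hk using Nat.le_induction with
  | base => norm_num
  | succ k _ ih =>
    calc 2 ^ (k + 1 + 10) = 2 * 2 ^ (k + 10) := by ring
      _ ≤ 2 * 3 ^ k := by gcongr
      _ ≤ 3 * 3 ^ k := by gcongr; norm_num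
      _ = 3 ^ (k + 1) := by ring

/-! ### The assembly, with the constants of `p ≥ 63` -/

/-- `α″ = 1509/385 = 2 + ρ + 1/11`: the constant absorbing `n²` into `C(n,3)` (`11·n² ≤ C(n,3)` for `n ≥ 69`). -/
def alphaL : ℚ := 1509 / 385

/-- For `n = p + d ≥ 69`: `L(p,d) ≤ α″·Φ(p,3)·C(n,3) + 4.2·C(n,3)` (the polynomial terms are absorbed). -/
theorem lhsU_le_low (p d : ℕ) (hn : 69 ≤ p + d) :
    lhsU p d ≤ alphaL * (phiK p 3 * (Nat.choose (p + d) 3 : ℚ)) + (42 / 10) * (Nat.choose (p + d) 3 : ℚ) := by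
  have hC : (11 * ((p + d : ℕ) : ℚ) ^ 2) ≤ (Nat.choose (p + d) 3 : ℚ) := by
    exact_mod_cast choose_three_ge_eleven_sq (p + d) hn
  have hC2 : (Nat.choose (p + d) 2 : ℚ) ≤ ((p + d : ℕ) : ℚ) ^ 2 := by
    exact_mod_cast Nat.choose_le_pow (p + d) 2
  have hn1 : (1 : ℚ) ≤ ((p + d : ℕ) : ℚ) := by exact_mod_cast (show 1 ≤ p + d by omega)
  have hsum : (∑ j ∈ range 4, (Nat.choose (p + d) j : ℚ))
      = 1 + ((p + d : ℕ) : ℚ) + (Nat.choose (p + d) 2 : ℚ) + (Nat.choose (p + d) 3 : ℚ) := by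
    simp [Finset.sum_range_succ]
  have hphi := phiK_three_nonneg p
  have hPn : phiK p 3 * ((p + d : ℕ) : ℚ) ^ 2 ≤ phiK p 3 * ((Nat.choose (p + d) 3 : ℚ) / 11) := by
    apply mul_le_mul_of_nonneg_left _ hphi
    linarith
  have expand : lhsU p d = (2 + 64 / 35) * (phiK p 3 * (Nat.choose (p + d) 3 : ℚ))
      + phiK p 3 * ((p + d : ℕ) : ℚ) ^ 2
      + (1 + ((p + d : ℕ) : ℚ) + (Nat.choose (p + d) 2 : ℚ) + (Nat.choose (p + d) 3 : ℚ))
      + (1 + 64 / 35) * (Nat.choose (p + d) 3 : ℚ) + ((p + d : ℕ) : ℚ) ^ 2 := by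
    unfold lhsU Ubound Rbound rhoCore
    rw [hsum]
    ring
  rw [expand]
  unfold alphaL
  nlinarith [hPn, hC, hC2, hn1]

/-- Polynomial tails against `2ⁿ` in `ℚ`, for `n ≥ 69`: `C(n,3) ≤ 2ⁿ/10⁴`. -/
theorem choose_three_le_two_pow_div_low (n : ℕ) (hn : 69 ≤ n) :
    (Nat.choose n 3 : ℚ) ≤ (2 : ℚ) ^ n / 10000 := by
  have h1 : Nat.choose n 3 ≤ n ^ 9 :=
    (Nat.choose_le_pow n 3).trans (Nat.pow_le_pow_right (by omega) (by norm_num))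
  have h2 := ten_thousand_pow_nine_le_two_pow_low n hn
  have h3 : 10000 * Nat.choose n 3 ≤ 2 ^ n := by
    calc 10000 * Nat.choose n 3 ≤ 10000 * n ^ 9 := by gcongr
      _ ≤ 2 ^ n := h2
  rw [le_div_iff₀ (by norm_num : (0 : ℚ) < 10000)]
  have : (Nat.choose n 3 : ℚ) * 10000 = ((10000 * Nat.choose n 3 : ℕ) : ℚ) := by push_cast; ring
  rw [this]
  exact_mod_cast h3

/-- Polynomial tails against `2ⁿ` in `ℚ`, for `n ≥ 69`: `Σ_{j≤d} C(n,j) ≤ 2ⁿ/1000` for `d ≤ 9`. -/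
theorem sum_range_choose_le_two_pow_div_low (n d : ℕ) (hn : 69 ≤ n) (hd : d ≤ 9) :
    (∑ j ∈ range (d + 1), (Nat.choose n j : ℚ)) ≤ (2 : ℚ) ^ n / 1000 := by
  have h1 := sum_range_choose_le_of_le_nine n d hd (by omega)
  have h2 := ten_thousand_pow_nine_le_two_pow_low n hn
  have h3 : 1000 * ∑ j ∈ range (d + 1), Nat.choose n j ≤ 2 ^ n := by
    calc 1000 * ∑ j ∈ range (d + 1), Nat.choose n j ≤ 1000 * (10 * n ^ 9) := by gcongr
      _ = 10000 * n ^ 9 := by ring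
      _ ≤ 2 ^ n := h2
  rw [le_div_iff₀ (by norm_num : (0 : ℚ) < 1000)]
  have : (∑ j ∈ range (d + 1), (Nat.choose n j : ℚ)) * 1000
      = ((1000 * ∑ j ∈ range (d + 1), Nat.choose n j : ℕ) : ℚ) := by push_cast; ring
  rw [this]
  exact_mod_cast h3

/-! ### Regime A, case A1: `6 ≤ d ≤ 9` (the tight case) -/

/-- Case A1 of THEOREM R3: `RegimeA p d` for `p ≥ 63`, `6 ≤ d ≤ 9`. -/
theorem regimeA_of_le_nine_low (p d : ℕ) (hp : 63 ≤ p) (hd6 : 6 ≤ d) (hd9 : d ≤ 9) : RegimeA p d := by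
  unfold RegimeA
  have hn69 : 69 ≤ p + d := by omega
  have hL := lhsU_le_low p d (by omega)
  have hF2 := phiK_mul_choose_mul_le p (p + d)
  -- `8·n ≤ 9·(p+1)`, the only place where `p ≥ 63` enters the ratio
  have hratio : (8 : ℚ) * ((p + d : ℕ) : ℚ) ≤ 9 * ((p : ℚ) + 1) := by
    have : 8 * (p + d) ≤ 9 * (p + 1) := by omega
    exact_mod_cast this
  have hratio3 : (8 : ℚ) ^ 3 * ((p + d : ℕ) : ℚ) ^ 3 ≤ 9 ^ 3 * ((p : ℚ) + 1) ^ 3 := by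
    have h := pow_le_pow_left₀ (by positivity) hratio 3
    calc (8 : ℚ) ^ 3 * ((p + d : ℕ) : ℚ) ^ 3 = (8 * ((p + d : ℕ) : ℚ)) ^ 3 := by ring
      _ ≤ (9 * ((p : ℚ) + 1)) ^ 3 := h
      _ = 9 ^ 3 * ((p : ℚ) + 1) ^ 3 := by ring
  have hpos : (0 : ℚ) < ((p : ℚ) + 1) ^ 3 := by positivity
  -- `Φ·C(n,3) ≤ 2^{p+3}·(9/8)³`
  have hPC : phiK p 3 * (Nat.choose (p + d) 3 : ℚ) ≤ (2 : ℚ) ^ (p + 3) * (9 / 8) ^ 3 := by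
    have h : (phiK p 3 * (Nat.choose (p + d) 3 : ℚ) * 8 ^ 3) * ((p : ℚ) + 1) ^ 3
        ≤ ((2 : ℚ) ^ (p + 3) * 9 ^ 3) * ((p : ℚ) + 1) ^ 3 := by
      calc (phiK p 3 * (Nat.choose (p + d) 3 : ℚ) * 8 ^ 3) * ((p : ℚ) + 1) ^ 3
          = (phiK p 3 * (Nat.choose (p + d) 3 : ℚ) * ((p : ℚ) + 1) ^ 3) * 8 ^ 3 := by ring
        _ ≤ ((2 : ℚ) ^ (p + 3) * ((p + d : ℕ) : ℚ) ^ 3) * 8 ^ 3 := by gcongr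
        _ = (2 : ℚ) ^ (p + 3) * (8 ^ 3 * ((p + d : ℕ) : ℚ) ^ 3) := by ring
        _ ≤ (2 : ℚ) ^ (p + 3) * (9 ^ 3 * ((p : ℚ) + 1) ^ 3) := by gcongr
        _ = ((2 : ℚ) ^ (p + 3) * 9 ^ 3) * ((p : ℚ) + 1) ^ 3 := by ring
    have h' := le_of_mul_le_mul_right h hpos
    have h8 : (0 : ℚ) < 8 ^ 3 := by norm_num
    calc phiK p 3 * (Nat.choose (p + d) 3 : ℚ)
        = (phiK p 3 * (Nat.choose (p + d) 3 : ℚ) * 8 ^ 3) / 8 ^ 3 := by field_simp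
      _ ≤ ((2 : ℚ) ^ (p + 3) * 9 ^ 3) / 8 ^ 3 := by gcongr
      _ = (2 : ℚ) ^ (p + 3) * (9 / 8) ^ 3 := by ring
  have htail := sum_range_choose_le_two_pow_div_low (p + d) d hn69 hd9
  have hC3 := choose_three_le_two_pow_div_low (p + d) hn69
  have hY : (2 : ℚ) ^ (p + 3) * 8 ≤ (2 : ℚ) ^ (p + d) := by
    have : (2 : ℚ) ^ (p + 3) * 8 = 2 ^ (p + 6) := by ring
    rw [this]
    exact pow_le_pow_right₀ (by norm_num) (by omega)
  have hc : (1509 / 385 : ℚ) * (9 / 8) ^ 3 / 8 + 42 / 100000 + 1 / 1000 ≤ 1 := by norm_num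
  have hphiC : (0 : ℚ) ≤ phiK p 3 * (Nat.choose (p + d) 3 : ℚ) :=
    mul_nonneg (phiK_three_nonneg p) (by positivity)
  unfold alphaL at hL
  nlinarith [hL, hPC, htail, hC3, hY, hc, hphiC]

/-! ### Regime A, case A2: `10 ≤ d ≤ p − 2` -/

/-- Case A2 of THEOREM R3: `RegimeA p d` for `p ≥ 63`, `10 ≤ d`, `d + 2 ≤ p`. -/
theorem regimeA_of_le_sub_two_low (p d : ℕ) (hp : 63 ≤ p) (hd10 : 10 ≤ d) (hdp : d + 2 ≤ p) :
    RegimeA p d := by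
  unfold RegimeA
  rw [sum_range_choose_eq_sub]
  have hn69 : 69 ≤ p + d := by omega
  have hL := lhsU_le_low p d (by omega)
  have hF2 := phiK_mul_choose_mul_le p (p + d)
  -- `n ≤ 2(p+1)` so `n³ ≤ 8(p+1)³`
  have hratio : ((p + d : ℕ) : ℚ) ≤ 2 * ((p : ℚ) + 1) := by
    have : p + d ≤ 2 * (p + 1) := by omega
    exact_mod_cast this
  have hratio3 : ((p + d : ℕ) : ℚ) ^ 3 ≤ 8 * ((p : ℚ) + 1) ^ 3 := by
    have h := pow_le_pow_left₀ (by positivity) hratio 3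
    calc ((p + d : ℕ) : ℚ) ^ 3 ≤ (2 * ((p : ℚ) + 1)) ^ 3 := h
      _ = 8 * ((p : ℚ) + 1) ^ 3 := by ring
  have hpos : (0 : ℚ) < ((p : ℚ) + 1) ^ 3 := by positivity
  have hPC : phiK p 3 * (Nat.choose (p + d) 3 : ℚ) ≤ (2 : ℚ) ^ (p + 3) * 8 := by
    have h : (phiK p 3 * (Nat.choose (p + d) 3 : ℚ)) * ((p : ℚ) + 1) ^ 3
        ≤ ((2 : ℚ) ^ (p + 3) * 8) * ((p : ℚ) + 1) ^ 3 := by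
      calc (phiK p 3 * (Nat.choose (p + d) 3 : ℚ)) * ((p : ℚ) + 1) ^ 3
          ≤ (2 : ℚ) ^ (p + 3) * ((p + d : ℕ) : ℚ) ^ 3 := hF2
        _ ≤ (2 : ℚ) ^ (p + 3) * (8 * ((p : ℚ) + 1) ^ 3) := by gcongr
        _ = ((2 : ℚ) ^ (p + 3) * 8) * ((p : ℚ) + 1) ^ 3 := by ring
    exact le_of_mul_le_mul_right h hpos
  have hC3 := choose_three_le_two_pow_div_low (p + d) hn69
  -- `2^{p+3}·8·16 = 2^{p+10} ≤ 2^{p+d}`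
  have hY : (2 : ℚ) ^ (p + 3) * 8 * 16 ≤ (2 : ℚ) ^ (p + d) := by
    have : (2 : ℚ) ^ (p + 3) * 8 * 16 = 2 ^ (p + 10) := by ring
    rw [this]
    exact pow_le_pow_right₀ (by norm_num) (by omega)
  -- the half sum: `2^{p+d} ≤ 2·Σ_{i<p} C(p+d,i)` since `p + d + 1 ≤ 2p`
  have hhalf : (2 : ℚ) ^ (p + d) ≤ 2 * ∑ i ∈ range p, (Nat.choose (p + d) i : ℚ) := by
    have h := two_pow_le_two_mul_sum_choose (p + d) p (by omega)
    exact_mod_cast h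
  have hphiC : (0 : ℚ) ≤ phiK p 3 * (Nat.choose (p + d) 3 : ℚ) :=
    mul_nonneg (phiK_three_nonneg p) (by positivity)
  unfold alphaL at hL
  nlinarith [hL, hPC, hC3, hY, hhalf, hphiC]

/-! ### Regime A, case A3: `p − 1 ≤ d ≤ 3p + 2` -/

/-- Case A3 of THEOREM R3: `RegimeA p d` for `p ≥ 63`, `p ≤ d + 1`, `d ≤ 3p + 2`. -/
theorem regimeA_of_le_three_mul_low (p d : ℕ) (hp : 63 ≤ p) (hdp : p ≤ d + 1) (hd : d ≤ 3 * p + 2) :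
    RegimeA p d := by
  unfold RegimeA
  rw [sum_range_choose_eq_sub]
  have hn69 : 69 ≤ p + d := by omega
  have hL := lhsU_le_low p d (by omega)
  have hF2 := phiK_mul_choose_mul_le p (p + d)
  -- `n ≤ 4(p+1)` so `n³ ≤ 64(p+1)³`
  have hratio : ((p + d : ℕ) : ℚ) ≤ 4 * ((p : ℚ) + 1) := by
    have : p + d ≤ 4 * (p + 1) := by omega
    exact_mod_cast this
  have hratio3 : ((p + d : ℕ) : ℚ) ^ 3 ≤ 64 * ((p : ℚ) + 1) ^ 3 := by
    have h := pow_le_pow_left₀ (by positivity) hratio 3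
    calc ((p + d : ℕ) : ℚ) ^ 3 ≤ (4 * ((p : ℚ) + 1)) ^ 3 := h
      _ = 64 * ((p : ℚ) + 1) ^ 3 := by ring
  have hpos : (0 : ℚ) < ((p : ℚ) + 1) ^ 3 := by positivity
  have hPC : phiK p 3 * (Nat.choose (p + d) 3 : ℚ) ≤ (2 : ℚ) ^ (p + 3) * 64 := by
    have h : (phiK p 3 * (Nat.choose (p + d) 3 : ℚ)) * ((p : ℚ) + 1) ^ 3
        ≤ ((2 : ℚ) ^ (p + 3) * 64) * ((p : ℚ) + 1) ^ 3 := by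
      calc (phiK p 3 * (Nat.choose (p + d) 3 : ℚ)) * ((p : ℚ) + 1) ^ 3
          ≤ (2 : ℚ) ^ (p + 3) * ((p + d : ℕ) : ℚ) ^ 3 := hF2
        _ ≤ (2 : ℚ) ^ (p + 3) * (64 * ((p : ℚ) + 1) ^ 3) := by gcongr
        _ = ((2 : ℚ) ^ (p + 3) * 64) * ((p : ℚ) + 1) ^ 3 := by ring
    exact le_of_mul_le_mul_right h hpos
  -- `C(n,3) ≤ n³ ≤ (4p+2)³` and `80·(4p+2)³ ≤ 4^p`
  have hC3 : (Nat.choose (p + d) 3 : ℚ) ≤ ((4 * p + 2 : ℕ) : ℚ) ^ 3 := by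
    have h1 : Nat.choose (p + d) 3 ≤ (p + d) ^ 3 := Nat.choose_le_pow _ _
    have h2 : (p + d) ^ 3 ≤ (4 * p + 2) ^ 3 := Nat.pow_le_pow_left (by omega) 3
    exact_mod_cast h1.trans h2
  have hcube : 80 * ((4 * p + 2 : ℕ) : ℚ) ^ 3 ≤ (4 : ℚ) ^ p := by
    exact_mod_cast eighty_mul_cube_le_four_pow_low p hp
  -- `2^{p+3}·64·(811/210)·8 ≤ 2^{p+14} ≤ 2^{2p}/2`
  have hexp : (2 : ℚ) ^ (p + 14) * 2 ≤ (4 : ℚ) ^ p := by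
    have : (4 : ℚ) ^ p = 2 ^ (2 * p) := by rw [show (4 : ℚ) = 2 ^ 2 by norm_num, ← pow_mul]
    rw [this]
    have : (2 : ℚ) ^ (p + 14) * 2 = 2 ^ (p + 15) := by ring
    rw [this]
    exact pow_le_pow_right₀ (by norm_num) (by omega)
  have hexp' : (2 : ℚ) ^ (p + 3) * 64 * 8 * 4 = (2 : ℚ) ^ (p + 14) := by ring
  -- the half sum at `2p − 2`, then monotonicity: `2^{2p−2} ≤ 2·Σ_{i<p} C(2p−2,i) ≤ 2·Σ_{i<p} C(p+d,i)`
  have hhalf : (2 : ℚ) ^ (2 * p) ≤ 8 * ∑ i ∈ range p, (Nat.choose (p + d) i : ℚ) := by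
    have h1 := two_pow_le_two_mul_sum_choose (2 * p - 2) p (by omega)
    have h2 := sum_range_choose_mono p (2 * p - 2) (p + d) (by omega)
    have h3 : 2 ^ (2 * p) = 4 * 2 ^ (2 * p - 2) := by
      rw [show 2 * p = (2 * p - 2) + 2 by omega]
      rw [Nat.add_sub_cancel]
      ring
    have h4 : 2 ^ (2 * p) ≤ 8 * ∑ i ∈ range p, Nat.choose (p + d) i := by
      rw [h3]
      omega
    exact_mod_cast h4
  have hfour : (4 : ℚ) ^ p = 2 ^ (2 * p) := by rw [show (4 : ℚ) = 2 ^ 2 by norm_num, ← pow_mul]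
  have hphiC : (0 : ℚ) ≤ phiK p 3 * (Nat.choose (p + d) 3 : ℚ) :=
    mul_nonneg (phiK_three_nonneg p) (by positivity)
  unfold alphaL at hL
  rw [hfour] at hexp hcube
  nlinarith [hL, hPC, hC3, hcube, hexp, hexp', hhalf, hphiC]

/-! ### Regime B′: `d ≥ 3p − 1` -/

/-- THEOREM R3 (B′): `RegimeB p d` for `p ≥ 63` and `3p ≤ d + 1`. -/
theorem regimeB_of_le_low (p d : ℕ) (hp : 63 ≤ p) (hd : 3 * p ≤ d + 1) : RegimeB p d := by
  unfold RegimeB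
  have hn69 : 69 ≤ p + d := by omega
  have hL := lhsU_le_low p d (by omega)
  -- `Φ ≤ 2^{p+3}` (crudely, `C(p+3,3) ≥ 1`)
  have hphi_le : phiK p 3 ≤ (2 : ℚ) ^ (p + 3) := by
    have h1 := phiK_three_mul_choose_le p
    have h2 : (1 : ℚ) ≤ (Nat.choose (p + 3) 3 : ℚ) := by
      exact_mod_cast Nat.choose_pos (by omega : 3 ≤ p + 3)
    have hphi := phiK_three_nonneg p
    calc phiK p 3 = phiK p 3 * 1 := by ring
      _ ≤ phiK p 3 * (Nat.choose (p + 3) 3 : ℚ) := mul_le_mul_of_nonneg_left h2 hphi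
      _ ≤ _ := h1
  have hCn : (0 : ℚ) ≤ (Nat.choose (p + d) 3 : ℚ) := by positivity
  -- `L ≤ 2^{p+6}·C(n,3)`
  have hL' : lhsU p d ≤ (2 : ℚ) ^ (p + 6) * (Nat.choose (p + d) 3 : ℚ) := by
    have h1 : phiK p 3 * (Nat.choose (p + d) 3 : ℚ) ≤ (2 : ℚ) ^ (p + 3) * (Nat.choose (p + d) 3 : ℚ) :=
      mul_le_mul_of_nonneg_right hphi_le hCn
    have h2 : (2 : ℚ) ≤ (2 : ℚ) ^ (p + 3) := by
      calc (2 : ℚ) = 2 ^ 1 := by norm_num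
        _ ≤ 2 ^ (p + 3) := pow_le_pow_right₀ (by norm_num) (by omega)
    have h3 : (2 : ℚ) ^ (p + 6) = 8 * (2 : ℚ) ^ (p + 3) := by ring
    have h4 : 2 * (Nat.choose (p + d) 3 : ℚ) ≤ (2 : ℚ) ^ (p + 3) * (Nat.choose (p + d) 3 : ℚ) := by
      nlinarith [h2, hCn]
    rw [h3]
    unfold alphaL at hL
    nlinarith [hL, h1, h4, hCn]
  -- now write `p = k + 4`: `2^{p+6} ≤ 3^k` and `3^k·C(n,3) ≤ C(n,k+3) = C(n,p−1)`
  obtain ⟨k, rfl⟩ : ∃ k, p = k + 4 := ⟨p - 4, by omega⟩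
  have h3pow : (2 : ℚ) ^ (k + 4 + 6) ≤ (3 : ℚ) ^ k := by
    exact_mod_cast two_pow_le_three_pow_low k (by omega)
  have hgrow : (3 : ℚ) ^ k * (Nat.choose (k + 4 + d) 3 : ℚ) ≤ (Nat.choose (k + 4 + d) (k + 3) : ℚ) := by
    exact_mod_cast three_pow_mul_choose_three_le (k + 4 + d) (k + 4) (by omega) k (le_refl _)
  have hsingle : (Nat.choose (k + 4 + d) (k + 3) : ℚ)
      ≤ ∑ u ∈ Ico 4 (k + 4), (Nat.choose (k + 4 + d) u : ℚ) := by
    apply single_le_sum (f := fun u => (Nat.choose (k + 4 + d) u : ℚ)) (fun _ _ => by positivity)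
    simp only [mem_Ico]
    omega
  calc lhsU (k + 4) d ≤ (2 : ℚ) ^ (k + 4 + 6) * (Nat.choose (k + 4 + d) 3 : ℚ) := hL'
    _ ≤ (3 : ℚ) ^ k * (Nat.choose (k + 4 + d) 3 : ℚ) := mul_le_mul_of_nonneg_right h3pow hCn
    _ ≤ (Nat.choose (k + 4 + d) (k + 3) : ℚ) := hgrow
    _ ≤ _ := hsingle

/-! ### THEOREM R3 -/

/-- THEOREM R3 (A): for every `p ≥ 63` and every `6 ≤ d ≤ 3p + 2`, regime A holds:
`Φ(p,3)·((2+ρ)C(n,3) + n²) + Σ_{j≤3} C(n,j) + (1+ρ)C(n,3) + n² + Σ_{j≤d} C(n,j) ≤ 2ⁿ`, `n = p + d`. -/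
theorem regimeA_of_le_low (p d : ℕ) (hp : 63 ≤ p) (hd6 : 6 ≤ d) (hd : d ≤ 3 * p + 2) : RegimeA p d := by
  rcases Nat.lt_or_ge d 10 with h9 | h10
  · exact regimeA_of_le_nine_low p d hp hd6 (by omega)
  · rcases Nat.lt_or_ge (d + 2) (p + 1) with hsmall | hbig
    · exact regimeA_of_le_sub_two_low p d hp h10 (by omega)
    · exact regimeA_of_le_three_mul_low p d hp (by omega) hd

/-- THEOREM R3: for every `p ≥ 63` and every `d ≥ 6`, regime A or regime B′ holds at `(p, d)`
(A on `d ≤ 3p + 2`, B′ on `d ≥ 3p − 1`) — residue (R3) of NIGHT-1 §13.4 closed in the kernel. -/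
theorem regime_of_six_le_low (p d : ℕ) (hp : 63 ≤ p) (hd : 6 ≤ d) : RegimeA p d ∨ RegimeB p d := by
  rcases Nat.lt_or_ge d (3 * p + 3) with h | h
  · exact Or.inl (regimeA_of_le_low p d hp hd (by omega))
  · exact Or.inr (regimeB_of_le_low p d hp (by omega))

end CoreRegimes
end PercRepro
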